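import Summits.HubbardSuperconductivity.HubbardSuperconductivity.Theorems.AnisotropyChordTransferFibre3N1RowTrueVec

/-!
# Route `AnisotropyChord` / H0 rotor rung, LEVEL 2 row `N₁`: the true vector lies in the cell box (base coordinates)

`…N1RowCheckSound.n1CellCheck_sound` needs `PMem (c.box a₁ a₂) X` for the true vector `X = xTrue L Δ λ₂ f a`: its first sixteen
coordinates are `L2.point L λ₂ a`, which lies in the cell box by `L2.point_mem_box` (`…Fibre3L2Vars`, from the twelve B1 kernel facts
`c.check = true`) whenever `L ≥ 128`, `ν = λ₂/θ² ∈ [n₁/νd, n₂/νd]` and `a ∈ [a₁, a₂]`.  ★ `pmem_xTrue`.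
Prover seat `hubbard-h0-rotor-p2` g4; helper for piece A = stmt-HubbardSuperconductivity-23918 of rung 19089
(`--supports`, helper class).  Nothing here proves superconductivity in the Hubbard model; helper lemma of ONE conditional
reduction (the GM₃ ∀L certificate, Level-2 row `N₁`); the rotor TARGET as originally worded stays FALSE (g15 verdict).
Mathlib + the tree only; no sorry.
-/

set_option linter.dupNamespace false
set_option autoImplicit false

open Literature.Analysis.ValidatedNumerics

namespace Summit.HubbardSuperconductivity.HubbardSuperconductivity.Theorems.AnisotropyChord.Transfer.Fibre3.L2.N1

/-- ★ the true vector is a prefix-member of the cell box (`L ≥ 128`, `(ν, a)` in the cell, the cell's kernel facts). -/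
theorem pmem_xTrue (c : L2.NamedCell) (hc : c.check = true) (a1 a2 : ℚ) (L : ℕ) [NeZero L] (hL : 128 ≤ L)
    (Δ lam2 : ℝ) (f : Tor L → ℝ) (a : ℝ)
    (hν1 : (c.n1 : ℝ) / c.νd ≤ lam2 / (2 * Real.pi / L) ^ 2) (hν2 : lam2 / (2 * Real.pi / L) ^ 2 ≤ (c.n2 : ℝ) / c.νd)
    (ha1 : ((a1 : ℚ) : ℝ) ≤ a) (ha2 : a ≤ ((a2 : ℚ) : ℝ)) :
    PMem (c.box a1 a2) (xTrue L Δ lam2 f a) := by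
  intro i hi
  have hlen : (c.box a1 a2).length = 16 := by simp [L2.NamedCell.box]
  rw [hlen] at hi
  have hm := L2.point_mem_box c hc a1 a2 L hL lam2 a hν1 hν2 ha1 ha2 i
  rw [xTrue_lt16 L Δ lam2 f a hi]
  exact hm

end Summit.HubbardSuperconductivity.HubbardSuperconductivity.Theorems.AnisotropyChord.Transfer.Fibre3.L2.N1
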